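import Literature.Algebra.Module.FreenessByRankCount
import Literature.Algebra.GroupRings.LocalGroupRingPGroup
import HarnessLib

/-!
# Freeness over `ℤ_p[G]` by a rank count (`G` a finite commutative `p`-group)

Assembly of `Literature/Algebra/Module/FreenessByRankCount.lean` (rank criterion + Nakayama over
a local algebra finite free over a domain) with `Literature/Algebra/GroupRings/LocalGroupRingPGroup.lean`
(`ℤ_p[G]` is local): for `Λ = ℤ_p[G]`, `I_G` the augmentation ideal, `M` a finite `Λ`-module and
`g : Fin r → M` whose images generate `M / I_G M`, the inequality `r · |G| ≤ rank_{ℤ_p} M` forces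
`g` to be a `Λ`-basis, so `M ≅ Λ^r`. Standard commutative algebra ([Matsumura1987, Thm. 2.3, §7];
[Serre1977, §15.6]); PROVED here (axioms `propext`, `Classical.choice`, `Quot.sound`).

USE (why it is here): this is the kernel-checked form of "LEMMA F (freeness), second proof" in the
venture cell `pub-abcsig`'s print-derived counting of Eisenstein-congruent newforms
(lit/FLIP-DERIVATION-T1.md §3) with `M = H₁(Y, S; ℤ_ℓ)₊`, `G = P`, `r = g₀ + s − 1`,
`rank M = |P|·r`; the generation hypothesis there is Lemma C + freeness of `H₁(Y₀, S₀; ℤ_ℓ)₊`,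
and the Riemann–Hurwitz rank count stays prose. Honest framing: pure commutative algebra; no
statement about modular forms or ABC. Authored by the cell's prover seat p1 (g9), 2026-08-23
(namespace `LemmaF` of its file); carried into `Literature/` with statements and proofs unchanged
(docstring, namespace, `open`s and citation tags by the literature seat).
-/

namespace Literature.Algebra.Module

open Literature.Algebra.GroupRings

namespace PadicGroupRingFreeness

open _root_.IsLocalRing _root_.Module

/-- `ℤ_p[G]` is finite free over `ℤ_p` of rank `|G|` (coefficientwise).
[cite: Serre1977, §6.1 («K[G] … has a basis indexed by the elements of G»; plumbing instance)] -/
instance moduleFree_padicGroupRing {p : ℕ} [Fact p.Prime] {G : Type*} [CommGroup G] :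
    Module.Free ℤ_[p] (MonoidAlgebra ℤ_[p] G) :=
  Module.Free.of_equiv (MonoidAlgebra.coeffLinearEquiv ℤ_[p]).symm

/-- `rank_{ℤ_p} ℤ_p[G] = |G|`.
[cite: Serre1977, §6.1 («K[G] … has a basis indexed by the elements of G») — plumbing; proved here] -/
lemma finrank_padicGroupRing {p : ℕ} [Fact p.Prime] {G : Type*} [CommGroup G] [Finite G] :
    finrank ℤ_[p] (MonoidAlgebra ℤ_[p] G) = Nat.card G := by
  classical
  haveI := Fintype.ofFinite G
  rw [(MonoidAlgebra.coeffLinearEquiv ℤ_[p]).finrank_eq, finrank_finsupp_self,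
    Nat.card_eq_fintype_card]

/-- **LEMMA F criterion over `Λ = ℤ_p[G]`** (`G` a finite commutative `p`-group): let `M` be a
finite `Λ`-module, `I_G = ker(aug)` the augmentation ideal, `g : Fin r → M` elements whose images
generate `M / I_G M`, and suppose `r · |G| ≤ rank_{ℤ_p} M`. Then `g` is a `Λ`-basis of `M`; in
particular `M ≅ Λ^r` is free of rank `r`. (In the T1 sheet: `M = H₁(Y, S; ℤ_ℓ)₊`, `G = P`,
`r = g₀ + s − 1`, `rank M = |P|·r`; the generation hypothesis is Lemma C + freeness of
`H₁(Y₀, S₀; ℤ_ℓ)₊`.) [cite: Matsumura1987, Thm. 2.3 with §7 (minimal generators = rank ⇒ free over a local ring) — standard; proved here] [cite: Serre1977, §15.6 (ℤ_p[G] local)] -/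
theorem padicGroupRing_basis_of_rank_criterion {p : ℕ} [Fact p.Prime] {G : Type*} [CommGroup G]
    [Finite G] (hG : IsPGroup p G) {M : Type*} [AddCommGroup M]
    [Module (MonoidAlgebra ℤ_[p] G) M] [Module ℤ_[p] M]
    [IsScalarTower ℤ_[p] (MonoidAlgebra ℤ_[p] G) M] [Module.Finite (MonoidAlgebra ℤ_[p] G) M]
    {r : ℕ} (g : Fin r → M)
    (hg : Submodule.span (MonoidAlgebra ℤ_[p] G) (Set.range g) ⊔
      (RingHom.ker (GroupRingLocal.aug : MonoidAlgebra ℤ_[p] G →ₐ[ℤ_[p]] ℤ_[p])) •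
        (⊤ : Submodule (MonoidAlgebra ℤ_[p] G) M) = ⊤)
    (hrank : r * Nat.card G ≤ finrank ℤ_[p] M) :
    ∃ b : Basis (Fin r) (MonoidAlgebra ℤ_[p] G) M, ⇑b = g := by
  haveI : IsLocalRing (MonoidAlgebra ℤ_[p] G) :=
    GroupRingLocal.isLocalRing_padicInt_monoidAlgebra hG
  have hI :
      RingHom.ker (GroupRingLocal.aug : MonoidAlgebra ℤ_[p] G →ₐ[ℤ_[p]] ℤ_[p]) ≠ ⊤ := by
    rw [Ne, Ideal.eq_top_iff_one, RingHom.mem_ker, map_one]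
    exact one_ne_zero
  have hrank' : r * finrank ℤ_[p] (MonoidAlgebra ℤ_[p] G) ≤ finrank ℤ_[p] M := by
    rwa [finrank_padicGroupRing]
  refine ⟨FreenessCriterion.basisOfRankCriterion (R := ℤ_[p]) hI g hg hrank', ?_⟩
  ext i
  simp [FreenessCriterion.basisOfRankCriterion, Basis.coe_ofEquivFun]

/-- Corollary: under the same hypotheses `M` is `Λ`-free of rank `r`.
[cite: Matsumura1987, Thm. 2.3 with §7 — standard; proved here] -/
theorem padicGroupRing_free_of_rank_criterion {p : ℕ} [Fact p.Prime] {G : Type*} [CommGroup G]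
    [Finite G] (hG : IsPGroup p G) {M : Type*} [AddCommGroup M]
    [Module (MonoidAlgebra ℤ_[p] G) M] [Module ℤ_[p] M]
    [IsScalarTower ℤ_[p] (MonoidAlgebra ℤ_[p] G) M] [Module.Finite (MonoidAlgebra ℤ_[p] G) M]
    {r : ℕ} (g : Fin r → M)
    (hg : Submodule.span (MonoidAlgebra ℤ_[p] G) (Set.range g) ⊔
      (RingHom.ker (GroupRingLocal.aug : MonoidAlgebra ℤ_[p] G →ₐ[ℤ_[p]] ℤ_[p])) •
        (⊤ : Submodule (MonoidAlgebra ℤ_[p] G) M) = ⊤)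
    (hrank : r * Nat.card G ≤ finrank ℤ_[p] M) :
    Module.Free (MonoidAlgebra ℤ_[p] G) M ∧ finrank (MonoidAlgebra ℤ_[p] G) M = r := by
  obtain ⟨b, -⟩ := padicGroupRing_basis_of_rank_criterion hG g hg hrank
  exact ⟨Module.Free.of_basis b, by simpa using finrank_eq_card_basis b⟩

end PadicGroupRingFreeness

end Literature.Algebra.Module
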